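import Summits.BirchSwinnertonDyer.BirchSwinnertonDyer.Theses.BiquadraticEisensteinDescent
import Literature.NumberTheory.EllipticCurves.HeegnerPoints
import Literature.NumberTheory.EllipticCurves.HeegnerPointsOfConductor
import Literature.NumberTheory.EllipticCurves.Rubin1983.BernoulliDescentSeven
import Literature.Barriers.BirchSwinnertonDyer.NoAdmissiblePrimesCMInert
import HarnessLib

set_option linter.dupNamespace false
set_option autoImplicit false

/-!
# Sketch (crux-ideate g0, round 1) — first lemmas of the three crux ideas for
# `HeegnerTwistCouplingInSupply` (stmt-BirchSwinnertonDyer-21381)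

One `def … : Prop` per card; nothing is asserted, nothing proved. Every constant is an existing
declaration (`lean search --decl`): `Rank1Residual.CMInert/Good/cmFieldDiscrOfJ`,
`IsImaginaryQuadratic`, `SatisfiesHeegnerHypothesis`, `IsHeegnerPoint`,
`Zhang2014.IsKolyvaginPrime`, `KrizLi2019.IsTeichmullerCharacter/IsKroneckerCharacterOf/bernoulliOnePrim`,
`Rubin1983.mulTeichmuller`, `cm7`, `WeierstrassCurve.quadraticTwist/entireLFunction/analyticRank/HasCM/conductorNorm`.
-/

noncomputable section

open scoped NumberField Classical
open WeierstrassCurve NumberField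
open Literature.NumberTheory.EllipticCurves
open Literature.NumberTheory.EllipticCurves.Rank1Residual

namespace Summit.BirchSwinnertonDyer.BirchSwinnertonDyer.Cruxes.HeegnerTwistCouplingInSupply

/-- The corner of the crux: `W` CM, analytic rank one, `p ≥ 5` inert in the CM field and bad. -/
def InCorner (W : WeierstrassCurve ℚ) [W.IsElliptic] [W.IsGloballyMinimal] (p : ℕ) [Fact p.Prime] :
    Prop :=
  W.HasCM ∧ W.analyticRank = 1 ∧ 5 ≤ p ∧ CMInert W p ∧ ¬ Good W p

/-- The conclusion of the crux for ONE field `K`: a Heegner field for `N_W` with `|d_K| > 4`,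
`L(W^{(d_K)}, 1) ≠ 0` and `p ∤ h_K`. The crux is `InCorner W p → (supply) → ∃ K, IsCouplingField W p K`. -/
def IsCouplingField (W : WeierstrassCurve ℚ) (p : ℕ) (K : Type) [Field K] [NumberField K] : Prop :=
  IsImaginaryQuadratic K ∧ 4 < (NumberField.discr K).natAbs ∧
    SatisfiesHeegnerHypothesis (W.conductorNorm ℤ) K ∧
    (W.quadraticTwist (NumberField.discr K : ℚ)).entireLFunction 1 ≠ 0 ∧
    ¬ p ∣ NumberField.classNumber K

/-! ## Card A — `kolyvagin-prime-jochnowitz` -/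

/-- **A1 (transfer, Gross–Zagier direction).** If a Heegner field `K'` with `p ∤ h(K')` carries a
Heegner point `P ∈ E(K')` that is NOT `p`-divisible in `E(K')`, then `K'` is a coupling field:
non-divisibility forces `P` non-torsion, Gross–Zagier gives `L'(E/K',1) ≠ 0`, and with
`ord_{s=1} L(W,s) = 1` this is `L(W^{(d')},1) ≠ 0`. The line then produces such a `K'` by detecting
`P ∉ pE(K')` LOCALLY at a Kolyvagin prime (Jochnowitz congruence). -/
def HeegnerIndivisibleTransfer : Prop :=
  ∀ (W : WeierstrassCurve ℚ) [W.IsElliptic] [W.IsGloballyMinimal] (p : ℕ) [Fact p.Prime]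
    [NeZero (W.conductorNorm ℤ)],
    InCorner W p →
    ∀ (K : Type) [Field K] [NumberField K],
      IsImaginaryQuadratic K → 4 < (NumberField.discr K).natAbs →
      SatisfiesHeegnerHypothesis (W.conductorNorm ℤ) K → ¬ p ∣ NumberField.classNumber K →
      (∃ P : (W.baseChange K).toAffine.Point,
          IsHeegnerPoint (W.conductorNorm ℤ) W K P ∧
            ∀ Q : (W.baseChange K).toAffine.Point, p • Q ≠ P) →
      IsCouplingField W p K

/-- **A2 (Kolyvagin-prime supply, Chebotarev).** For the corner pair `(W, p)` and any imaginary
quadratic `K'` with `p ∤ d_{K'}` there are arbitrarily large primes `q` which are Kolyvagin primes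
for `(W, K', p)` in Zhang's numerical sense (`q ∤ N p d_{K'}`, `q` inert in `K'`,
`p ∣ gcd(q+1, a_q)`) and inert in the CM field (`a_q = 0`): Frobenius = complex conjugation in
`K K'(W[p])/ℚ`. These are the level-raising primes of the line (BD1999 §2), replacing the EMPTY
supply of BD2005-admissible primes (`noAdmissiblePrimesCMInert_holds`). -/
def KolyvaginPrimeSupply : Prop :=
  ∀ (W : WeierstrassCurve ℚ) [W.IsElliptic] [W.IsGloballyMinimal] (p : ℕ) [Fact p.Prime]
    [NeZero (W.conductorNorm ℤ)],
    InCorner W p →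
    ∀ (K : Type) [Field K] [NumberField K],
      IsImaginaryQuadratic K → ¬ (p : ℤ) ∣ NumberField.discr K →
      ∀ B : ℕ, ∃ q : ℕ, B < q ∧
        Zhang2014.IsKolyvaginPrime (W.conductorNorm ℤ) W K p q ∧ CMInert W q

/-! ## Card B — `rubin-bernoulli-switch` (CM field `ℚ(√−λ)`, `λ ∈ {7,11,19,43,67,163}`; typed at `λ = 7`) -/

/-- **B1 (Rubin 1983 Thm 1 switch at `λ = 7`).** For `W` in the corner with CM by `ℚ(√−7)` (so `W`
is a quadratic twist of `A(7) = cm7`), a Heegner field `K'` with `p ∤ h(K')`, and the real quadratic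
field `M` with `7 ∤ d_M` over which `W^{(d')}` becomes isomorphic to `A(7)` (i.e.
`W^{(d')} ≅ A(7)^{(d_M)}`): if the generalised Bernoulli number `B_{1, χ_M ω}` is a `7`-adic unit
then `L(W^{(d')}, 1) ≠ 0` (Rubin, Invent. 71 (1983) Thm 1: `L(ψ̄χ_M,1)/Ω ≡ unit·B_{1,χ_Mω}²
(mod √−7)`), hence `K'` is a coupling field. The `L`-value condition of the crux becomes
`7 ∤ B_{2,χ_{d_M}}/2` — a Cohen number `H(2,|d_M|)` of the SAME species as `h(d')`. -/
def RubinBernoulliSwitchSeven : Prop :=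
  ∀ (W : WeierstrassCurve ℚ) [W.IsElliptic] [W.IsGloballyMinimal] (p : ℕ) [Fact p.Prime]
    [NeZero (W.conductorNorm ℤ)],
    InCorner W p → cmFieldDiscrOfJ W.j = -7 →
    ∀ (ω : DirichletCharacter ℚ_[7] 7), KrizLi2019.IsTeichmullerCharacter ω →
    ∀ (K : Type) [Field K] [NumberField K],
      IsImaginaryQuadratic K → 4 < (NumberField.discr K).natAbs →
      SatisfiesHeegnerHypothesis (W.conductorNorm ℤ) K → ¬ p ∣ NumberField.classNumber K →
    ∀ (M : Type) [Field M] [NumberField M] [NeZero (NumberField.discr M).natAbs],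
      Module.finrank ℚ M = 2 → ¬ ((7 : ℤ) ∣ NumberField.discr M) →
    ∀ (εM : DirichletCharacter ℚ_[7] (NumberField.discr M).natAbs),
      KrizLi2019.IsKroneckerCharacterOf M εM →
      (∃ C : VariableChange M,
          C • cm7.baseChange M = (W.quadraticTwist (NumberField.discr K : ℚ)).baseChange M) →
      ¬ ‖KrizLi2019.bernoulliOnePrim (Rubin1983.mulTeichmuller εM ω)‖ ≤ (7 : ℝ)⁻¹ →
      IsCouplingField W p K

/-! ## Card C — `frobenius-field-theta-log` (sub-case `e = 2`: `W = W₀ ⊗ χ_{p*}`, `p ∤ N_{W₀}`) -/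

/-- `K` is a FROBENIUS FIELD of the prime `p`: `K = ℚ(√(t² − 4p))` for some integer `0 < |t| < 2√p`,
i.e. `d_K · m² = t² − 4p`. Then `p = N((t + m√d_K)/2)` splits PRINCIPALLY in `K`, `|d_K| < 4p`, so
`h_K < p`: the class-number conjunct and the Heegner condition at `p` of the crux hold for free. -/
def IsFrobeniusField (p : ℕ) (K : Type) [Field K] [NumberField K] : Prop :=
  IsImaginaryQuadratic K ∧ ∃ t m : ℤ, t ≠ 0 ∧ NumberField.discr K * m ^ 2 = t ^ 2 - 4 * (p : ℤ)

/-- **C1 (the free half).** A Frobenius field of `p ≥ 5` has `p` split and class number `< p`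
(`h(d) ≤ (√|d|/π)(log|d| + 2) < p` for `|d| < 4p`), hence `p ∤ h_K`. Elementary; the explicit
class-number upper bound is the only non-Mathlib input. -/
def FrobeniusFieldAutomatic : Prop :=
  ∀ (p : ℕ) [Fact p.Prime], 5 ≤ p →
    ∀ (K : Type) [Field K] [NumberField K], IsFrobeniusField p K →
      ((Ideal.span {(p : ℤ)}).primesOver (𝓞 K)).ncard = 2 ∧ NumberField.classNumber K < p

/-- **C2 (transfer `C⁺_C ⇒ crux` in the sub-case `e = 2`).** For `W ≅ W₀ ⊗ χ_{p*}` in the corner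
(`W₀` the twist-core, `p ∤ N_{W₀}`): a Frobenius field `K'` of `p` with `|d_{K'}| > 4`, Heegner for
`N_{W₀}`, and `L(W^{(d_{K'})}, 1) ≠ 0` is a coupling field — Heegner for `N_W = N_{W₀}p²` because `p`
splits in `K'`, and `p ∤ h(K')` by C1. The line then proves `L ≠ 0` for SOME admissible Frobenius
field by the mod-`p` formula `log_ω y_{K'} ≡ Σ_σ (θ^{(p−3)/2} f̄_{W₀} / A^{(p−1)/2})(x̄_σ)` on
`X₀(N_{W₀})^{ord}_{𝔽_p}`, whose `𝔽_p`-points are tiled by exactly these orbits (Deuring–Ihara). -/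
def FrobeniusTwistSuffices : Prop :=
  ∀ (W₀ : WeierstrassCurve ℚ) [W₀.IsElliptic] (p : ℕ) [Fact p.Prime],
    ¬ p ∣ W₀.conductorNorm ℤ →
    ∀ (W : WeierstrassCurve ℚ) [W.IsElliptic] [W.IsGloballyMinimal] [NeZero (W.conductorNorm ℤ)],
      InCorner W p →
      (∃ C : VariableChange ℚ,
          C • W₀.quadraticTwist ((if p % 4 = 1 then (p : ℤ) else -(p : ℤ)) : ℚ) = W) →
      ∀ (K : Type) [Field K] [NumberField K],
        IsFrobeniusField p K → 4 < (NumberField.discr K).natAbs →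
        SatisfiesHeegnerHypothesis (W₀.conductorNorm ℤ) K →
        (W.quadraticTwist (NumberField.discr K : ℚ)).entireLFunction 1 ≠ 0 →
        IsCouplingField W p K

end Summit.BirchSwinnertonDyer.BirchSwinnertonDyer.Cruxes.HeegnerTwistCouplingInSupply

end
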